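import Summits.HodgeConjecture.CorCM.Census.TwoAdicSplittingTrace

/-!
# Two-adic splitting relative to a `2`-subgroup, III: the RESIDUAL trace test

COR-CM (cell `pub-hodgecm2`), count-neutral kernel combinatorics by the binder seat b09 (gen 40; lane RELATIVE SPLITTING, part IV), sequel of
`Census/TwoAdicSplittingTrace.lean` (gen 40: `trace_hodge2_le_psp2` — the principal part is free; `hodge2_le_of_fibre_of_trace`) on top of
`Census/TwoAdicSplittingRelative.lean` and seat b23ʼs `Census/OddIndexGeneration.lean`, all BY NAME.  Theorems only: no definition, no `decide`,
no certificate, no named fact, no `sorry`.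
HONEST FRAMING: `HC_CM` is NOT proved, here or anywhere in the tree; nothing here is a period or a headline.

THE POINT.  In the META shape of the lane (`Census/NondegenerateSplitting(Relative).lean`) a face family `S` always CONTAINS A COVERING FAMILY of a
base type `T₀` (`Splitting.exists_cover_sub`, any `(G,c)`): modulo `ℤ⟨pairs⟩ + ℤ[G]·S` every CM type is an integer combination of the RESIDUAL types
(potential `≤ 1`).  Then the projected condition of part II — `y + tr_N y ∈ T(S)` — needs checking ONLY on the Hodge vectors mod `2` supported on the
residual types (`hodge2_le_of_fibre_of_trace_supported`; the set `R` is arbitrary: any set of types onto which `S` reduces mod `2`), and the law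
`μ(G,c) = φ₂(G,c)` follows from the fibre, generation after inverting `2`, the reduction onto `R` and that residual projected condition
(`isLeast_card_gfaces_generate_of_isPGroup_trace_supported`).  And a GROUP-FREE form (`hodge2_le_of_cover_of_supported`,
`hodgeSpan_le_of_cover_of_supported`, `isLeast_card_gfaces_generate_of_cover_of_supported`, ANY `(G,c)`): if the Hodge vectors mod `2` supported on
`R` are themselves generated mod `2`, no Nakayama is needed at all and fibre-independence only COUNTS.  For the quaternion column `Q_{4n}` (`n = 2^a m`, `N = ⟨u^{2^{a+1}}⟩`) the residual
types are the base changes of `T₀ = A ⊔ xA` and of its single flips — `2n − 1` blocks.  Numerics (`HOME/pub-hodgecm2-b09/lean-g40/RELATIVE-SPLITTING.md`):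
for `Q₂₄` gen 39ʼs plan-S family (`21` faces) plus a greedy far cover (`151` faces) is a fibre basis (`172 = φ₂ = β` faces) which ALREADY generates
mod `2` — the projected condition holds there with room to spare.

## References
* [Pohlmann1968] H. Pohlmann, Algebraic cycles on abelian varieties of complex multiplication type, Ann. of Math. 88 (1968), Thm 1.
* [Milne1999] J. S. Milne, Lefschetz motives and the Tate conjecture, Compositio Math. 117 (1999), Prop. 2.1, p. 54.
-/

namespace Summit.HodgeConjecture.CorCM.Census.Splitting

open Finset
open Summit.HodgeConjecture.CorCM.Prior.AllgGroup.RfwfAllgGroup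
open Summit.HodgeConjecture.CorCM.Census.BlockParity
open Summit.HodgeConjecture.CorCM.Census.Coinvariant
open Summit.HodgeConjecture.CorCM.Census.OddIndex

noncomputable section

variable {G : Type*} [Group G] [Fintype G] [DecidableEq G] (c : G)
variable (N : Subgroup G) [DecidablePred (· ∈ N)]

section Rel

variable {Γ : Type*} [Group Γ]

/-! ## The residual test: with a covering family only the Hodge vectors supported on the residual types need projecting -/

omit [Group Γ] in
/-- Every vector mod `2` splits as a member of the target plus a vector supported on `R`, as soon as every single CM type does. [folklore] -/
theorem mem_psp2_sup_supported (S : Finset (CMF G c →₀ ZMod 2)) (R : Set (CMF G c))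
    (hR : ∀ Φ : CMF G c, Finsupp.single Φ (1 : ZMod 2) ∈
      (pair2 c ⊔ Submodule.span (ZMod 2) (translates2 c S)) ⊔ Finsupp.supported (ZMod 2) (ZMod 2) R)
    (x : CMF G c →₀ ZMod 2) :
    x ∈ (pair2 c ⊔ Submodule.span (ZMod 2) (translates2 c S)) ⊔ Finsupp.supported (ZMod 2) (ZMod 2) R := by
  induction x using Finsupp.induction with
  | zero => exact Submodule.zero_mem _
  | single_add Φ a f _ _ hf =>
    refine Submodule.add_mem _ ?_ hf
    have e : Finsupp.single Φ a = a • Finsupp.single Φ (1 : ZMod 2) := by rw [Finsupp.smul_single, smul_eq_mul, mul_one]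
    rw [e]
    exact Submodule.smul_mem _ a (hR Φ)

/-- **RESIDUAL TEST.**  `G = ι(Γ)·N` (`Γ` a `2`-group, `N` normal), `c` central; `S ⊆ hodge2` spans the coinvariant fibre and every CM type reduces mod
`2`, modulo the target of `S`, to types in a set `R` (e.g. `S` contains a covering family of a base type `T₀` and `R` = the RESIDUAL types of
potential `≤ 1`, `Census/BaseBlockCovering.lean`).  If `y + tr_N y ∈ T(S)` for every Hodge vector `y` mod `2` SUPPORTED ON `R`, then `S` generates
mod `2`. [folklore] -/
theorem hodge2_le_of_fibre_of_trace_supported (hΓ : IsPGroup 2 Γ) (ι : Γ →* G) (hNn : ∀ g : G, ∀ n ∈ N, g * n * g⁻¹ ∈ N)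
    (hcov : ∀ Q : G, ∃ γ : Γ, ∃ n ∈ N, Q = ι γ * n)
    (hc2 : c * c = 1) (hcen : ∀ x : G, x * c = c * x)
    (S : Finset (CMF G c →₀ ZMod 2)) (hS : (S : Set (CMF G c →₀ ZMod 2)) ⊆ hodge2 c hc2)
    (h : hodge2 c hc2 ≤ rad2 c hc2 ⊔ Submodule.span (ZMod 2) (S : Set (CMF G c →₀ ZMod 2)))
    (R : Set (CMF G c)) (hR : ∀ Φ : CMF G c, Finsupp.single Φ (1 : ZMod 2) ∈
      (pair2 c ⊔ Submodule.span (ZMod 2) (translates2 c S)) ⊔ Finsupp.supported (ZMod 2) (ZMod 2) R)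
    (hF : ∀ y ∈ hodge2 c hc2, y ∈ Finsupp.supported (ZMod 2) (ZMod 2) R →
      y + ∑ n ∈ univ.filter (· ∈ N), Finsupp.mapDomain (rt c n) y ∈ pair2 c ⊔ Submodule.span (ZMod 2) (translates2 c S)) :
    hodge2 c hc2 ≤ pair2 c ⊔ Submodule.span (ZMod 2) (translates2 c S) := by
  intro x hx
  obtain ⟨t, ht, r, hr, hxe⟩ := Submodule.mem_sup.mp (mem_psp2_sup_supported c S R hR x)
  have hrH : r ∈ hodge2 c hc2 := by
    have e : r = x - t := by rw [← hxe]; abel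
    rw [e]
    exact Submodule.sub_mem _ hx (psp2_le_hodge2 c hc2 hcen S hS ht)
  have h1 : x + ∑ n ∈ univ.filter (· ∈ N), Finsupp.mapDomain (rt c n) x ∈ pair2 c ⊔ Submodule.span (ZMod 2) (translates2 c S) := by
    have e : x + ∑ n ∈ univ.filter (· ∈ N), Finsupp.mapDomain (rt c n) x =
        (t + ∑ n ∈ univ.filter (· ∈ N), Finsupp.mapDomain (rt c n) t) + (r + ∑ n ∈ univ.filter (· ∈ N), Finsupp.mapDomain (rt c n) r) := by
      rw [← hxe]
      simp only [Finsupp.mapDomain_add, Finset.sum_add_distrib]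
      abel
    rw [e]
    exact Submodule.add_mem _ (Submodule.add_mem _ ht (trace_mem_psp2 c N hcen S ht)) (hF r hrH hr)
  have h2 := trace_hodge2_le_psp2 c N hΓ ι hNn hcov hc2 hcen S hS h hx
  have e : x = (x + ∑ n ∈ univ.filter (· ∈ N), Finsupp.mapDomain (rt c n) x) +
      ∑ n ∈ univ.filter (· ∈ N), Finsupp.mapDomain (rt c n) x := by
    rw [add_assoc, add_self_finsuppTwo, add_zero]
  rw [e]
  exact Submodule.add_mem _ h1 h2

omit [Group Γ] in
/-- Reducing an integral covering hypothesis (`Census/NondegenerateSplitting`: every type is a member of `ℤ⟨pairs⟩ + ℤ[G]·S₀` plus a combination of the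
types in `R`) to the mod-`2` form used by the residual test. [folklore] -/
theorem single_mem_psp2_sup_supported_of_cover (S₀ : Finset (CMF G c →₀ ℤ)) (R : Set (CMF G c))
    (hcv : ∀ Φ : CMF G c, Finsupp.single Φ (1 : ℤ) ∈
      (Submodule.span ℤ (pairSet c) ⊔ Submodule.span ℤ (translates c S₀)) ⊔
        Submodule.span ℤ ((fun Ψ => Finsupp.single Ψ (1 : ℤ)) '' R)) (Φ : CMF G c) :
    Finsupp.single Φ (1 : ZMod 2) ∈
      (pair2 c ⊔ Submodule.span (ZMod 2) (translates2 c (S₀.image (red c)))) ⊔ Finsupp.supported (ZMod 2) (ZMod 2) R := by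
  obtain ⟨n, hn, r, hr, he⟩ := Submodule.mem_sup.mp (hcv Φ)
  have e : Finsupp.single Φ (1 : ZMod 2) = red c n + red c r := by
    rw [← map_add, he, red_single, Int.cast_one]
  rw [e]
  refine Submodule.add_mem _ (Submodule.mem_sup_left (red_mem_psp2 c S₀ hn)) (Submodule.mem_sup_right ?_)
  have hle : Submodule.map (red c) (Submodule.span ℤ ((fun Ψ => Finsupp.single Ψ (1 : ℤ)) '' R)) ≤
      (Finsupp.supported (ZMod 2) (ZMod 2) R).restrictScalars ℤ := by
    rw [Submodule.map_span, Submodule.span_le]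
    rintro _ ⟨_, ⟨Ψ, hΨ, rfl⟩, rfl⟩
    rw [red_single, Int.cast_one]
    exact Finsupp.single_mem_supported (ZMod 2) (1 : ZMod 2) hΨ
  exact hle (Submodule.mem_map_of_mem hr)

/-- **`μ(G,c) = φ₂(G,c)` by the residual trace test.**  `G = ι(Γ)·N` (`Γ` a `2`-group, `N` normal), `c` central `≠ 1`; `S₀` a fibre-independent
face family which generates after inverting `2` and reduces every CM type, modulo `ℤ⟨pairs⟩ + ℤ[G]·S₀`, to the types of a set `R` (a covering family
does, `Splitting.exists_cover_sub`); if `y + tr_N y ∈ pair2 + 𝔽₂⟨base changes of red S₀⟩` for every Hodge vector `y` mod `2` supported on `R`,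
then `μ(G,c) = φ₂(G,c)`. [folklore] -/
theorem isLeast_card_gfaces_generate_of_isPGroup_trace_supported (hΓ : IsPGroup 2 Γ) (ι : Γ →* G)
    (hNn : ∀ g : G, ∀ n ∈ N, g * n * g⁻¹ ∈ N) (hcov : ∀ Q : G, ∃ γ : Γ, ∃ n ∈ N, Q = ι γ * n)
    (hc2 : c * c = 1) (hc1 : c ≠ 1) (hcen : ∀ x : G, x * c = c * x)
    (S₀ : Finset (CMF G c →₀ ℤ)) (hS₀ : (↑S₀ : Set (CMF G c →₀ ℤ)) ⊆ gfaceSet G c hc2)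
    (hli : LinearIndepOn (ZMod 2) (fun f : CMF G c →₀ ℤ => (rad2 c hc2).mkQ (red c f)) ↑S₀)
    (R : Set (CMF G c)) (hcv : ∀ Φ : CMF G c, Finsupp.single Φ (1 : ℤ) ∈
      (Submodule.span ℤ (pairSet c) ⊔ Submodule.span ℤ (translates c S₀)) ⊔
        Submodule.span ℤ ((fun Ψ => Finsupp.single Ψ (1 : ℤ)) '' R))
    (hF : ∀ y ∈ hodge2 c hc2, y ∈ Finsupp.supported (ZMod 2) (ZMod 2) R →
      y + ∑ n ∈ univ.filter (· ∈ N), Finsupp.mapDomain (rt c n) y ∈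
        pair2 c ⊔ Submodule.span (ZMod 2) (translates2 c (S₀.image (red c))))
    (k : ℕ) (htwo : ∀ y ∈ hodgeSpan c hc2,
      ((2 : ℤ) ^ k) • y ∈ Submodule.span ℤ (pairSet c) ⊔ Submodule.span ℤ (translates c S₀)) :
    IsLeast {n : ℕ | ∃ S : Finset (CMF G c →₀ ℤ), (↑S ⊆ gfaceSet G c hc2) ∧ S.card = n ∧
      hodgeSpan c hc2 ≤ Submodule.span ℤ (pairSet c) ⊔ Submodule.span ℤ (translates c S)} (fibreTwo c hc2) := by
  refine ⟨?_, ?_⟩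
  · obtain ⟨S, hS₀S, hS, hcard, hle⟩ := exists_faces_extension c hc2 S₀ hS₀ hli
    have hSH : (↑S : Set (CMF G c →₀ ℤ)) ⊆ hodgeSpan c hc2 := hS.trans (gfaceSet_subset_hodgeSpan c hc2)
    have hmono2 : (pair2 c ⊔ Submodule.span (ZMod 2) (translates2 c (S₀.image (red c)))) ⊔ Finsupp.supported (ZMod 2) (ZMod 2) R ≤
        (pair2 c ⊔ Submodule.span (ZMod 2) (translates2 c (S.image (red c)))) ⊔ Finsupp.supported (ZMod 2) (ZMod 2) R :=
      sup_le_sup_right (fun x hx => cobdry_mono c hS₀S hx) _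
    have h2 := hodge2_le_of_fibre_of_trace_supported c N hΓ ι hNn hcov hc2 hcen (S.image (red c))
      (image_red_subset_hodge2 c hc2 S hSH) hle R
      (fun Φ => hmono2 (single_mem_psp2_sup_supported_of_cover c S₀ R hcv Φ))
      fun y hy hyR => cobdry_mono c hS₀S (hF y hy hyR)
    obtain ⟨m, hm, hodd⟩ := exists_odd_smul_mem_of_hodge2_le c hc2 hc1 hcen S hSH h2
    have hsub : translates c S₀ ⊆ translates c S := by
      rintro _ ⟨Q, s, hs, rfl⟩
      exact ⟨Q, s, hS₀S hs, rfl⟩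
    have hmono : Submodule.span ℤ (pairSet c) ⊔ Submodule.span ℤ (translates c S₀) ≤
        Submodule.span ℤ (pairSet c) ⊔ Submodule.span ℤ (translates c S) :=
      sup_le_sup_left (Submodule.span_mono hsub) _
    exact ⟨S, hS, hcard, generate_of_odd_smul_of_two_pow_smul c hc2 S hm k hodd fun y hy => hmono (htwo y hy)⟩
  · rintro n ⟨S, hS, rfl, hgen⟩
    exact fibreTwo_le_card_of_faces c hc2 hcen S hS fun y hy => hgen (gfaceSet_subset_hodgeSpan c hc2 hy)

end Rel

/-! ## The group-free form: residual generation mod `2` replaces Nakayama altogether -/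

/-- **GROUP-FREE RESIDUAL CRITERION (mod `2`).**  ANY finite `G`, central `c`.  If every CM type reduces mod `2`, modulo the target of `S ⊆ hodge2`,
to the types of a set `R`, and every Hodge vector mod `2` supported on `R` lies in the target, then `S` generates mod `2`.  (No `2`-group, no
fibre: `x = t + r` with `r` a Hodge vector supported on `R`.) [folklore] -/
theorem hodge2_le_of_cover_of_supported (hc2 : c * c = 1) (hcen : ∀ x : G, x * c = c * x)
    (S : Finset (CMF G c →₀ ZMod 2)) (hS : (S : Set (CMF G c →₀ ZMod 2)) ⊆ hodge2 c hc2)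
    (R : Set (CMF G c)) (hR : ∀ Φ : CMF G c, Finsupp.single Φ (1 : ZMod 2) ∈
      (pair2 c ⊔ Submodule.span (ZMod 2) (translates2 c S)) ⊔ Finsupp.supported (ZMod 2) (ZMod 2) R)
    (hres : ∀ y ∈ hodge2 c hc2, y ∈ Finsupp.supported (ZMod 2) (ZMod 2) R → y ∈ pair2 c ⊔ Submodule.span (ZMod 2) (translates2 c S)) :
    hodge2 c hc2 ≤ pair2 c ⊔ Submodule.span (ZMod 2) (translates2 c S) := by
  intro x hx
  obtain ⟨t, ht, r, hr, hxe⟩ := Submodule.mem_sup.mp (mem_psp2_sup_supported c S R hR x)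
  have hrH : r ∈ hodge2 c hc2 := by
    have e : r = x - t := by rw [← hxe]; abel
    rw [e]
    exact Submodule.sub_mem _ hx (psp2_le_hodge2 c hc2 hcen S hS ht)
  rw [← hxe]
  exact Submodule.add_mem _ ht (hres r hrH hr)

/-- **GROUP-FREE RESIDUAL CRITERION, integral form.**  ANY finite `G`, central `c ≠ 1`.  A finite family `S₀` of integer Hodge vectors which
(i) reduces every CM type, modulo `ℤ⟨pairs⟩ + ℤ[G]·S₀`, to integer combinations of the types of `R` (a covering family does), (ii) generates mod `2`
every Hodge vector mod `2` supported on `R`, and (iii) generates after inverting `2`, GENERATES: `hodgeSpan ≤ ℤ⟨pairs⟩ + ℤ[G]·S₀`.  For the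
quaternion column (`R` = residual types of `T₀ = A ⊔ xA`, `S₀ ⊇` gen 39ʼs `qfam`, `k = 1`) hypothesis (ii) is the ONE statement left for general
even `n`; numerically `qfam` alone satisfies it for `Q₁₆` (`48/48`) and `Q₂₄` (`120/120`). [folklore] -/
theorem hodgeSpan_le_of_cover_of_supported (hc2 : c * c = 1) (hc1 : c ≠ 1) (hcen : ∀ x : G, x * c = c * x)
    (S₀ : Finset (CMF G c →₀ ℤ)) (hS₀ : (↑S₀ : Set (CMF G c →₀ ℤ)) ⊆ hodgeSpan c hc2)
    (R : Set (CMF G c)) (hcv : ∀ Φ : CMF G c, Finsupp.single Φ (1 : ℤ) ∈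
      (Submodule.span ℤ (pairSet c) ⊔ Submodule.span ℤ (translates c S₀)) ⊔
        Submodule.span ℤ ((fun Ψ => Finsupp.single Ψ (1 : ℤ)) '' R))
    (hres : ∀ y ∈ hodge2 c hc2, y ∈ Finsupp.supported (ZMod 2) (ZMod 2) R →
      y ∈ pair2 c ⊔ Submodule.span (ZMod 2) (translates2 c (S₀.image (red c))))
    (k : ℕ) (htwo : ∀ y ∈ hodgeSpan c hc2,
      ((2 : ℤ) ^ k) • y ∈ Submodule.span ℤ (pairSet c) ⊔ Submodule.span ℤ (translates c S₀)) :
    hodgeSpan c hc2 ≤ Submodule.span ℤ (pairSet c) ⊔ Submodule.span ℤ (translates c S₀) := by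
  have h2 := hodge2_le_of_cover_of_supported c hc2 hcen (S₀.image (red c)) (image_red_subset_hodge2 c hc2 S₀ hS₀) R
    (single_mem_psp2_sup_supported_of_cover c S₀ R hcv) hres
  obtain ⟨m, hm, hodd⟩ := exists_odd_smul_mem_of_hodge2_le c hc2 hc1 hcen S₀ hS₀ h2
  exact generate_of_odd_smul_of_two_pow_smul c hc2 S₀ hm k hodd htwo

/-- **`μ(G,c) = φ₂(G,c)` BY THE GROUP-FREE RESIDUAL CRITERION.**  ANY finite `G`, central `c ≠ 1`: a FIBRE-INDEPENDENT face family `S₀` with (i)–(iii)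
of `hodgeSpan_le_of_cover_of_supported` generates, and has exactly `φ₂(G,c)` members — fibre-independence is used only to COUNT
(`Splitting.card_le_fibreTwo_of_fibreIndep`), not to generate. [folklore] -/
theorem isLeast_card_gfaces_generate_of_cover_of_supported (hc2 : c * c = 1) (hc1 : c ≠ 1) (hcen : ∀ x : G, x * c = c * x)
    (S₀ : Finset (CMF G c →₀ ℤ)) (hS₀ : (↑S₀ : Set (CMF G c →₀ ℤ)) ⊆ gfaceSet G c hc2)
    (hli : LinearIndepOn (ZMod 2) (fun f : CMF G c →₀ ℤ => (rad2 c hc2).mkQ (red c f)) ↑S₀)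
    (R : Set (CMF G c)) (hcv : ∀ Φ : CMF G c, Finsupp.single Φ (1 : ℤ) ∈
      (Submodule.span ℤ (pairSet c) ⊔ Submodule.span ℤ (translates c S₀)) ⊔
        Submodule.span ℤ ((fun Ψ => Finsupp.single Ψ (1 : ℤ)) '' R))
    (hres : ∀ y ∈ hodge2 c hc2, y ∈ Finsupp.supported (ZMod 2) (ZMod 2) R →
      y ∈ pair2 c ⊔ Submodule.span (ZMod 2) (translates2 c (S₀.image (red c))))
    (k : ℕ) (htwo : ∀ y ∈ hodgeSpan c hc2,
      ((2 : ℤ) ^ k) • y ∈ Submodule.span ℤ (pairSet c) ⊔ Submodule.span ℤ (translates c S₀)) :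
    S₀.card = fibreTwo c hc2 ∧
    IsLeast {n : ℕ | ∃ S : Finset (CMF G c →₀ ℤ), (↑S ⊆ gfaceSet G c hc2) ∧ S.card = n ∧
      hodgeSpan c hc2 ≤ Submodule.span ℤ (pairSet c) ⊔ Submodule.span ℤ (translates c S)} (fibreTwo c hc2) := by
  have hgen := hodgeSpan_le_of_cover_of_supported c hc2 hc1 hcen S₀ (hS₀.trans (gfaceSet_subset_hodgeSpan c hc2)) R hcv hres k htwo
  have hle : S₀.card ≤ fibreTwo c hc2 := card_le_fibreTwo_of_fibreIndep c hc2 S₀ hS₀ hli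
  have hge : fibreTwo c hc2 ≤ S₀.card :=
    fibreTwo_le_card_of_faces c hc2 hcen S₀ hS₀ fun y hy => hgen (gfaceSet_subset_hodgeSpan c hc2 hy)
  have hcard : S₀.card = fibreTwo c hc2 := le_antisymm hle hge
  refine ⟨hcard, ⟨S₀, hS₀, hcard, hgen⟩, ?_⟩
  rintro n ⟨S, hS, rfl, hgen'⟩
  exact fibreTwo_le_card_of_faces c hc2 hcen S hS fun y hy => hgen' (gfaceSet_subset_hodgeSpan c hc2 hy)

end

end Summit.HodgeConjecture.CorCM.Census.Splitting
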